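import Literature.AlgebraicGeometry.Frobenioids.PadicFrobenioidThm12
import Literature.AlgebraicGeometry.Frobenioids.PadicFrobenioidDatumLemmas
import HarnessLib

/-!
# Frobenioids II, Theorem 1.2 (ii), (iii) for `p`-adic Frobenioids — PROVED

Mochizuki, *The geometry of Frobenioids II*, Kyushu J. Math. **62** (2008) 401–460, §1, Theorem 1.2,
kurims pp. 9–10 [cite: MochizukiFrdII2008, Thm 1.2 pp.9-10]. PROOF-ONLY companion of
`PadicFrobenioidThm12.lean` (abc-iut-L1-t4; node `FrdII:Thm1.2`, seat abc-iut-L1-d8) for the `p`-adic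
Frobenioid `C = d.frobenioid` of a `PadicFrd.Datum d`, over the datum lemmas of
`PadicFrobenioidDatumLemmas.lean` (abc-iut-L1-d10) and the generic model-Frobenioid mechanisms of
`ModelFrobenioidAmpleness.lean` / `ModelFrobenioidCofinal.lean`:

* **Theorem 1.2 (ii)**, both clauses, as typed (`thm12_ii_holds`): the action of `Aut_C(A)` on
  `O^⊳(A)` by conjugation factors through `Aut_{D₀}(A₀)` (conjugation formula + "`Φ(g)`, `B(g)` only
  depend on the image of `g` in `D₀`"), and (here `Λ = ℤ`) the factorization is faithful: an
  automorphism acting trivially on the endomorphisms `(1, id, 0, u)`, `u ∈ B(A)` over the units of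
  `O_{K_A}`, has base automorphism fixing `O_{K_A}^×` pointwise, hence fixing `K_A` — a
  valuation-theoretic remark (`ringHom_ext_of_eqOn_valuation_eq_one`): every element of `K` is a unit,
  `(1 + x) - 1` with `1 + x` a unit, or the inverse of such;
* **Theorem 1.2 (iii)** (`thm12_iii_holds`): `D` has a terminal object ⇒ `C` has a pseudo-terminal
  object, from cofinality of `Div_B` (`Φ` monoprime, `B` group-like, `Div_B` nonzero).
No definitions; nothing asserted beyond what is proved.
-/

namespace Literature.AlgebraicGeometry.Frobenioids

open CategoryTheory Opposite Function
open scoped ValuativeRel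

universe v u

namespace PadicFrd

/-! ### A valuation-theoretic remark: ring homomorphisms agreeing on units of `O_K` agree -/

/-- Two ring homomorphisms out of a valued field that agree on the elements of valuation `1` agree
everywhere: an element of valuation `< 1` is `(1 + x) - 1` with `v(1 + x) = 1`, and an element of
valuation `> 1` is the inverse of one of valuation `< 1`. [cite: MochizukiFrdII2008, Thm 1.2 (ii) p.9] -/
theorem ringHom_ext_of_eqOn_valuation_eq_one {K : Type u} [Field K] [ValuativeRel K] {L : Type*}
    [DivisionRing L] (σ τ : K →+* L) (h : ∀ x : K, ValuativeRel.valuation K x = 1 → σ x = τ x) :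
    σ = τ := by
  have hlt : ∀ x : K, ValuativeRel.valuation K x < 1 → σ x = τ x := by
    intro x hx
    have h1 : σ (1 + x) = τ (1 + x) := h _ (Valuation.map_one_add_of_lt _ hx)
    rw [map_add, map_add, map_one, map_one] at h1
    exact add_left_cancel h1
  refine RingHom.ext fun x => ?_
  rcases lt_trichotomy (ValuativeRel.valuation K x) 1 with hx | hx | hx
  · exact hlt x hx
  · exact h x hx
  · have hinv : ValuativeRel.valuation K x⁻¹ < 1 := by
      rw [map_inv₀]
      exact inv_lt_one_of_one_lt₀ hx
    have := hlt _ hinv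
    rw [map_inv₀, map_inv₀] at this
    exact inv_injective this

variable {D : Type u} [Category.{v} D] {p : ℕ} [Fact p.Prime]

namespace Datum

variable (d : Datum D p)

/-! ### Theorem 1.2 (ii) -/

/-- **Theorem 1.2 (ii)**, first clause (FrdII p. 9): "the natural action of `Aut_C(A)` on `O^⊳(A)`,
`O^×(A)` factors through `Aut_{D₀}(A₀)`" — automorphisms `α, β` of `A` with the same image in
`Aut_{D₀}(A₀)` conjugate every base-identity linear endomorphism identically (conjugation formula
`α ∘ f ∘ α⁻¹ = (1, id, Φ(g)(Div f), B(g)(u_f))` with `Φ(g)`, `B(g)` determined by `g₀`).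
[cite: MochizukiFrdII2008, Thm 1.2 (ii) p.9] -/
theorem conj_eq_conj_of_mapIso_eq (A : d.frobenioid) (α β : Aut A)
    (h : d.toBaseZero.mapIso α = d.toBaseZero.mapIso β) :
    ∀ f ∈ PreFrobenioid.endSubmonoid d.structureFunctor A, α.hom ≫ f ≫ α.inv = β.hom ≫ f ≫ β.inv := by
  have hbase : d.base.map (ModelFrobenioid.baseMap α.hom) = d.base.map (ModelFrobenioid.baseMap β.hom) :=
    congrArg Iso.hom h
  intro f hf
  exact ModelFrobenioid.conj_eq_conj_of_map_eq α β (d.mapΦ_eq_of_baseMap_eq _ _ hbase)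
    (d.mapB_eq_of_baseMap_eq _ _ hbase) f hf

/-- **Theorem 1.2 (ii)**, second clause for `Λ = ℤ` (FrdII p. 9): "this factorization determines a
faithful action of the image of `Aut_C(A)` in `Aut_{D₀}(A₀)` on `O^⊳(A)`, `O^×(A)`": if `α, β` conjugate
every base-identity linear endomorphism identically, then — testing on the endomorphisms
`(1, id, 0, u)` for `u ∈ B(A)` over `x ∈ O_{K_A}^×`, whose conjugates have unit parts over
`σ_α(x)`, `σ_β(x)` — the base field endomorphisms `σ_α, σ_β` of `K_A` agree on `O_{K_A}^×`, hence
everywhere, i.e. `α, β` have the same image in `Aut_{D₀}(A₀)`. [cite: MochizukiFrdII2008, Thm 1.2 (ii) p.9] -/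
theorem mapIso_eq_of_conj_eq_conj (A : d.frobenioid) (α β : Aut A)
    (h : ∀ f ∈ PreFrobenioid.endSubmonoid d.structureFunctor A,
      α.hom ≫ f ≫ α.inv = β.hom ≫ f ≫ β.inv) :
    d.toBaseZero.mapIso α = d.toBaseZero.mapIso β := by
  apply Iso.ext
  change d.base.map (ModelFrobenioid.baseMap α.hom) = d.base.map (ModelFrobenioid.baseMap β.hom)
  apply PadicFld.hom_ext
  apply ringHom_ext_of_eqOn_valuation_eq_one
  intro x hx
  have hx0 : x ≠ 0 := by
    rintro rfl
    rw [map_zero] at hx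
    exact zero_ne_one hx
  -- the unit `x ∈ O_{K_A}^×`, an element `b ∈ B(A)` over `(x, 0)`, and the endomorphism `(1, id, 0, b)`
  obtain ⟨b, hbu, hbd⟩ := d.exists_B_over_unit (op A.base) (Units.mk0 x hx0) hx
  obtain ⟨f, hf₁, hf₂, -, hfu⟩ := ModelFrobenioid.exists_end_of_divB_eq_one A b hbd
  have hf : f ∈ PreFrobenioid.endSubmonoid d.structureFunctor A := ⟨hf₂, hf₁⟩
  have hconj := ModelFrobenioid.mapB_unit_eq_of_conj_eq α β f hf₁ hf₂ (h f hf)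
  rw [hfu] at hconj
  -- push to `B₀ = K^×` via `B → B₀`
  have hB0 := congrArg (fun y => @Units.val (d.fld A.base) _ ((d.toB0.app (op A.base)).hom y)) hconj
  change @Units.val (d.fld A.base) _
      ((d.B.map (ModelFrobenioid.baseMap α.hom).op ≫ d.toB0.app (op A.base)).hom b) =
    @Units.val (d.fld A.base) _
      ((d.B.map (ModelFrobenioid.baseMap β.hom).op ≫ d.toB0.app (op A.base)).hom b) at hB0
  rw [d.toB0.naturality, d.toB0.naturality] at hB0
  change @Units.val (d.fld A.base) _ (Units.map
      ((d.base.map (ModelFrobenioid.baseMap α.hom)).alg : d.fld A.base →* d.fld A.base)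
      ((d.toB0.app (op A.base)).hom b)) =
    @Units.val (d.fld A.base) _ (Units.map
      ((d.base.map (ModelFrobenioid.baseMap β.hom)).alg : d.fld A.base →* d.fld A.base)
      ((d.toB0.app (op A.base)).hom b)) at hB0
  rw [hbu, Units.coe_map, Units.coe_map, MonoidHom.coe_coe, MonoidHom.coe_coe] at hB0
  exact hB0

/-- **Theorem 1.2 (ii)** (FrdII p. 9), as typed in `PadicFrobenioidThm12.lean` (`Λ = ℤ`): the
conjugation action of `Aut_C(A)` on the base-identity linear endomorphisms factors through
`Aut_{D₀}(A₀)`, faithfully. [cite: MochizukiFrdII2008, Thm 1.2 (ii) p.9] -/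
theorem thm12_ii_holds : Thm12_ii d :=
  ⟨fun A α β h => d.conj_eq_conj_of_mapIso_eq A α β h,
    fun A α β h => d.mapIso_eq_of_conj_eq_conj A α β h⟩

/-! ### Theorem 1.2 (iii) -/

/-- **Theorem 1.2 (iii)** (FrdII p. 9): "If `D` admits a terminal object, then `C` admits a
pseudo-terminal object": for `T` terminal in `D`, `(T, 0)` is pseudo-terminal, every `(A_D, α)` mapping
to it by `(1, A_D → T, x, u)` with `-α + Div_B(u) = x` (cofinality of `Div_B`).
[cite: MochizukiFrdII2008, Thm 1.2 (iii) p.9] -/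
theorem thm12_iii_holds : Thm12_iii d :=
  fun hT => ModelFrobenioid.exists_isPseudoTerminal_of_cofinal d.divB_cofinal hT

end Datum

end PadicFrd

end Literature.AlgebraicGeometry.Frobenioids
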